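import Summits.Ventures.LatticeQCDFlow.Exactness.IMHMultiProposalPoolEstimator
import Summits.Ventures.LatticeQCDFlow.Exactness.IMHMultiProposalMinorisation
import Summits.Ventures.LatticeQCDFlow.Exactness.IMHTotalVariationContraction
import HarnessLib

/-!
# The batch read-out of the multi-proposal flow sampler from ANY start: after `t` updates its mean is within `c·(1 − (m+1)/(2W+m))ᵗ` of `π f`

HONEST FRAMING: exact (Metropolis-corrected) sampling algorithms for lattice gauge theory;
figures of merit are autocorrelation/cost numbers at stated couplings and volumes; no
continuum-physics claim.

Venture `LatticeQCDFlow` (cell pub-lqcd), topic `Exactness`; FANOUT row 30 (lean-1, GEN-41).  NEW WORK of the cell, composing three GEN-41 ∕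
GEN-37 files: `IMHMultiProposalPoolEstimator` (at equilibrium the pool-weighted read-out `A_f(z) = Σ_j w(z_j)f(z_j)/W(z)` over the current state
and the `m + 1` fresh proposals is exactly unbiased), `IMHMultiProposalMinorisation` (from every start the pool-selection chain is within
`(1 − ε)ᵗ` of `π` set by set, `ε = (m + 1)/(2W + m)` for a weight bounded by `W`) and `IMHTotalVariationContraction` (set-wise closeness controls
bounded observables).  Object: the CONDITIONAL MEAN READ-OUT `h(x) = E[A_f(x ∷ y)]` over the fresh proposals `y ∼ q^{⊗(m+1)}` — what the batch
reports on average when the chain sits at `x`.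

* §1 `poolReadout_measurable`, `poolReadout_nonneg`, `poolReadout_le` — `h` is measurable with `0 ≤ h ≤ c` for `0 ≤ f ≤ c`;
  `integral_poolReadout_target` — `∫ h dπ = ∫ f dπ` (GEN-41's unbiasedness, restated for `h`).
* §2 **`multiProposal_poolReadout_bias_le`** — for every initial law `μ₀` and every `t`:
  `|∫ h d(μ₀Pᵗ) − ∫ f dπ| ≤ c·(1 − (m + 1)/(2W + m))ᵗ` — the expected batch read-out after `t` updates from a cold or any start is within a
  geometrically small bias of the target value, at the batch rate of `IMHMultiProposalMinorisation`.
Reading (gauge files): start the ensemble gauge sampler anywhere, run `t` batch updates, report the weight-averaged observable over the last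
batch: its expectation misses the Wilson-law value by at most `c·(1 − (m + 1)/(2W + m))ᵗ`.  NOT CLAIMED: the variance of the read-out; time
averages along the run; unbounded weights.  No `sorry`, no new definitions, nothing cited as a fact.
-/

noncomputable section

namespace Summit.Ventures.LatticeQCDFlow.Exactness

open MeasureTheory ProbabilityTheory Function Finset
open scoped ENNReal

variable {Ω : Type*} [MeasurableSpace Ω] {q : Measure Ω} [IsProbabilityMeasure q] {w : Ω → ℝ} {m : ℕ}

/-! ## §1 The conditional mean read-out -/

/-- Measurability of the `ℝ≥0∞` pool average of `ofReal ∘ f`. [ours, bookkeeping] -/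
theorem measurable_poolAverage (hw : Measurable w) {f : Ω → ℝ} (hf : Measurable f) :
    Measurable fun z : Fin (m + 2) → Ω => (∑ j, ENNReal.ofReal (w (z j)) * ENNReal.ofReal (f (z j))) / ∑ i, ENNReal.ofReal (w (z i)) :=
  (Finset.measurable_sum _ fun j _ => (hw.ennreal_ofReal.comp (measurable_pi_apply j)).mul
    (hf.ennreal_ofReal.comp (measurable_pi_apply j))).div (Finset.measurable_sum _ fun i _ => hw.ennreal_ofReal.comp (measurable_pi_apply i))

omit [MeasurableSpace Ω] in
/-- The pool average of `ofReal ∘ f` is at most `ofReal c` when `f ≤ c` and `w > 0`. [ours, bookkeeping] -/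
theorem poolAverage_le (hw0 : ∀ y, 0 < w y) {f : Ω → ℝ} {c : ℝ} (hfc : ∀ y, f y ≤ c) (z : Fin (m + 2) → Ω) :
    (∑ j, ENNReal.ofReal (w (z j)) * ENNReal.ofReal (f (z j))) / (∑ i, ENNReal.ofReal (w (z i))) ≤ ENNReal.ofReal c := by
  have hW := sum_weight_pos_ne_top hw0 z
  refine (ENNReal.div_le_iff hW.1 hW.2).2 ?_
  rw [Finset.mul_sum]
  exact Finset.sum_le_sum fun j _ => by rw [mul_comm]; exact mul_le_mul' (ENNReal.ofReal_le_ofReal (hfc _)) le_rfl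

/-- **The conditional mean read-out `h(x) = E_y[A_f(x ∷ y)]` is measurable.** [ours, bookkeeping] -/
theorem poolReadout_measurable (hw : Measurable w) {f : Ω → ℝ} (hf : Measurable f) :
    Measurable fun x : Ω => (∫⁻ y, (∑ j, ENNReal.ofReal (w (Fin.cons (α := fun _ : Fin (m + 2) => Ω) x y j)) *
        ENNReal.ofReal (f (Fin.cons (α := fun _ : Fin (m + 2) => Ω) x y j))) /
        (∑ i, ENNReal.ofReal (w (Fin.cons (α := fun _ : Fin (m + 2) => Ω) x y i))) ∂(Measure.pi fun _ : Fin (m + 1) => q)).toReal :=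
  (measurable_cons_comp (measurable_poolAverage hw hf)).lintegral_prod_right'.ennreal_toReal

/-- `0 ≤ h(x) ≤ c` for `0 ≤ f ≤ c` (and the inner integral is finite). [ours, bookkeeping] -/
theorem poolReadout_le (hw0 : ∀ y, 0 < w y) {f : Ω → ℝ} {c : ℝ} (hc : 0 ≤ c) (hfc : ∀ y, f y ≤ c) (x : Ω) :
    (∫⁻ y, (∑ j, ENNReal.ofReal (w (Fin.cons (α := fun _ : Fin (m + 2) => Ω) x y j)) *
        ENNReal.ofReal (f (Fin.cons (α := fun _ : Fin (m + 2) => Ω) x y j))) /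
        (∑ i, ENNReal.ofReal (w (Fin.cons (α := fun _ : Fin (m + 2) => Ω) x y i))) ∂(Measure.pi fun _ : Fin (m + 1) => q)) ≤ ENNReal.ofReal c ∧
    (∫⁻ y, (∑ j, ENNReal.ofReal (w (Fin.cons (α := fun _ : Fin (m + 2) => Ω) x y j)) *
        ENNReal.ofReal (f (Fin.cons (α := fun _ : Fin (m + 2) => Ω) x y j))) /
        (∑ i, ENNReal.ofReal (w (Fin.cons (α := fun _ : Fin (m + 2) => Ω) x y i))) ∂(Measure.pi fun _ : Fin (m + 1) => q)).toReal ≤ c := by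
  have h1 : (∫⁻ y, (∑ j, ENNReal.ofReal (w (Fin.cons (α := fun _ : Fin (m + 2) => Ω) x y j)) *
        ENNReal.ofReal (f (Fin.cons (α := fun _ : Fin (m + 2) => Ω) x y j))) /
        (∑ i, ENNReal.ofReal (w (Fin.cons (α := fun _ : Fin (m + 2) => Ω) x y i))) ∂(Measure.pi fun _ : Fin (m + 1) => q)) ≤ ENNReal.ofReal c :=
    (lintegral_mono fun y => poolAverage_le hw0 hfc _).trans (by rw [lintegral_const, measure_univ, mul_one])
  exact ⟨h1, (ENNReal.toReal_mono ENNReal.ofReal_ne_top h1).trans_eq (ENNReal.toReal_ofReal hc)⟩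

/-- **`∫ h dπ = ∫ f dπ`**: the conditional mean read-out is unbiased at equilibrium (`0 ≤ f ≤ c`). [ours] -/
theorem integral_poolReadout_target (hw : Measurable w) (hw0 : ∀ y, 0 < w y) [IsProbabilityMeasure (q.withDensity fun x => ENNReal.ofReal (w x))]
    {f : Ω → ℝ} (hf : Measurable f) (hf0 : ∀ y, 0 ≤ f y) {c : ℝ} (hfc : ∀ y, f y ≤ c) :
    ∫ x, (∫⁻ y, (∑ j, ENNReal.ofReal (w (Fin.cons (α := fun _ : Fin (m + 2) => Ω) x y j)) *
        ENNReal.ofReal (f (Fin.cons (α := fun _ : Fin (m + 2) => Ω) x y j))) /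
        (∑ i, ENNReal.ofReal (w (Fin.cons (α := fun _ : Fin (m + 2) => Ω) x y i))) ∂(Measure.pi fun _ : Fin (m + 1) => q)).toReal
        ∂(q.withDensity fun x => ENNReal.ofReal (w x)) =
      ∫ x, f x ∂(q.withDensity fun x => ENNReal.ofReal (w x)) :=
  multiProposal_poolAverage_integral_eq (n := m + 1) hw hw0 hf hf0 hfc

/-! ## §2 The bias from any start -/

/-- **THE BATCH READ-OUT FROM ANY START**: pool-selection kernel `P` with `m + 1` fresh proposals, weight `0 < w ≤ W` with `π = w·q` a probability
law, observable `0 ≤ f ≤ c` measurable; for every initial law `μ₀` and every `t`: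
`|∫ h d(μ₀Pᵗ) − ∫ f dπ| ≤ c·(1 − (m + 1)/(2W + m))ᵗ`, `h` the conditional mean read-out. [ours] -/
theorem multiProposal_poolReadout_bias_le (hw : Measurable w) (hw0 : ∀ y, 0 < w y) {W : ℝ} (hwW : ∀ y, w y ≤ W)
    [IsProbabilityMeasure (q.withDensity fun y => ENNReal.ofReal (w y))] (P : Kernel Ω Ω)
    (hP : ∀ (x : Ω) {B : Set Ω}, MeasurableSet B → P x B = ∫⁻ y, (∑ j, ENNReal.ofReal (w (Fin.cons (α := fun _ : Fin (m + 2) => Ω) x y j)) *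
      B.indicator (fun _ => (1 : ℝ≥0∞)) (Fin.cons (α := fun _ : Fin (m + 2) => Ω) x y j)) /
      (∑ i, ENNReal.ofReal (w (Fin.cons (α := fun _ : Fin (m + 2) => Ω) x y i))) ∂(Measure.pi fun _ : Fin (m + 1) => q))
    {f : Ω → ℝ} (hf : Measurable f) (hf0 : ∀ y, 0 ≤ f y) {c : ℝ} (hfc : ∀ y, f y ≤ c)
    (μ₀ : Measure Ω) [IsProbabilityMeasure μ₀] (t : ℕ) :
    |∫ x, (∫⁻ y, (∑ j, ENNReal.ofReal (w (Fin.cons (α := fun _ : Fin (m + 2) => Ω) x y j)) *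
        ENNReal.ofReal (f (Fin.cons (α := fun _ : Fin (m + 2) => Ω) x y j))) /
        (∑ i, ENNReal.ofReal (w (Fin.cons (α := fun _ : Fin (m + 2) => Ω) x y i))) ∂(Measure.pi fun _ : Fin (m + 1) => q)).toReal
        ∂((fun ν : Measure Ω => ν.bind P)^[t] μ₀) -
      ∫ x, f x ∂(q.withDensity fun x => ENNReal.ofReal (w x))| ≤ c * (1 - (m + 1) / (2 * W + m)) ^ t := by
  set π : Measure Ω := q.withDensity fun x => ENNReal.ofReal (w x) with hπ
  haveI : IsMarkovKernel P := ⟨fun x => ⟨multiProposal_apply_univ hw0 P hP x⟩⟩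
  haveI := isProbabilityMeasure_iterate_bind (κ := P) μ₀ t
  have hc : 0 ≤ c := by
    obtain ⟨y⟩ := nonempty_of_isProbabilityMeasure q
    exact (hf0 y).trans (hfc y)
  have hsetwise : ∀ C, MeasurableSet C → |((fun ν : Measure Ω => ν.bind P)^[t] μ₀).real C - π.real C| ≤ (1 - (m + 1) / (2 * W + m)) ^ t :=
    fun C _ => multiProposal_uniformlyErgodic hw hw0 hwW P hP μ₀ t C
  have hobs := abs_integral_sub_integral_le_mul_of_setwise ((fun ν : Measure Ω => ν.bind P)^[t] μ₀) π hsetwise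
    (poolReadout_measurable (q := q) (m := m) hw hf)
    (fun x => ENNReal.toReal_nonneg) (fun x => (poolReadout_le (q := q) (m := m) hw0 hc hfc x).2)
  rw [integral_poolReadout_target hw hw0 hf hf0 hfc, sub_zero] at hobs
  exact hobs

end Summit.Ventures.LatticeQCDFlow.Exactness
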